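import Summits.QuantumFields.BalabanUV.Beta.FP.WilsonCubicGerm

/-!
# `BalabanUV.Beta.FP.SliceVertex` — road «FP» for binder row D1, row H2V-2 (owner b2b-balaban-beta-d1-p3, R-FP-23 ∕ `H2V-DESIGN.md` §4), part 1 of 2:
# THE BACKGROUND-FEYNMAN SLICE `½|D*_B W|²` AT FIRST ORDER — its one-bond Hessian vertex is MINUS the longitudinal vertex of the Wilson action (in BF
# Feynman gauge the longitudinal vertex CANCELS), its `ℤ⁴` stencil `sliceStn`, and the packed-fibre family `sliceA` (part 2 = `FP/SliceCubicGerm`: the germ)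

HONEST DEPENDENCY (page 1, mandatory): continuum YM on T⁴ ⇐ BetaPertH ∧ nine spine estimates (0/9 proved); BetaPertH ⇐ (D1) ∧ (D4) ∧ CAP+tail;
G-an2-4 gates asym, D1 and NE2/3/4.  HONEST FRAMING (cell contract, verbatim): «discharging `BetaPertH` makes Bałaban's UV stability UNCONDITIONAL —
a real constructive-QFT result; it is NOT the continuum limit and NOT the Clay problem.»  THIS MODULE DISCHARGES NOTHING of the wall: finite non-commutative
algebra BY NAME over an3's `PlaquetteWeitzenbock` ∕ `PlaquetteStencil` ∕ `WilsonStencilZ4` and list bookkeeping, typing the gauge-fixing term's `B·Q·Q` vertex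
in the SAME parametrisation `U_b = e^{W_b}e^{B_b}` and the SAME `ad(t_c)`-stripping convention (`StepJetData` §5) as the Wilson family `wilsonA`.
`[our object]`∕`[folklore]` throughout; nothing cited, no `def … : Prop`, no `sorry`.  NOT the perfect action's jets (H2V-4), NOT H2-ASM, NOT hgerm, NOT (CONV-C),
NOT D1, NOT BetaPertH, NOT continuum, NOT Clay.

ABSOLUTE RULE (cell charter, verbatim): «No internally-minted statement may enter as a cited fact. Every hypothesis is either kernel-proved in this package or a
verbatim quotation of a PUBLISHED theorem with page reference. The manuscript(s) under audit are NOT citable for their own disputed steps — they are the thing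
under adjudication; programme-internal (2001/route/tribunal) claims are never citable.»  B9 = [Balaban1985BackgroundPropagators] (3.8) (the covariant adjoint
`D*`) and (3.26) (`Δ_a = Δ + DRD* + Q*aQ`) are CONTEXT only — where the printed objects live; nothing printed is a hypothesis.

THE SLICE IS ALREADY HALF IN THE TREE.  an3's `PlaquetteWeitzenbock.covDiv₁ e W B x = divW e W x + divTwist e W B x` IS the first-order (in `B`) covariant
backward divergence `−(D*_B W)(x)` of B9 (3.8) in the cell's parametrisation (the incoming letter `W_μ(x−e_μ)` transported to `x` by `R(e^{B_μ(x−e_μ)})⁻¹ =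
1 − [B_μ(x−e_μ), ·] + …`), `sum_covDiv₁_sq : Σ_x τ(covDiv₁²) = Σ τ(divW²) + 2•divGerm + Σ τ(divTwist²)`, and `PlaquetteStencil.divGerm_field_bondLetter :
divGerm τ e (field t v) (bondLetter z γ Y) = v ⬝ᵥ (divVertex e z γ (adM τ t Y)) *ᵥ v`.

WHAT IS PROVED.
* §1 RING LEVEL (any ring `𝔸` that is an `ℝ`-algebra, `ℝ`-linear tracial `τ`, finite periodic `Λ`, frame `e`).  The BACKGROUND-FEYNMAN SLICE FUNCTIONAL at
  first order **`sliceForm₁ τ e W B := −½·Σ_x τ(covDiv₁ e W B x · covDiv₁ e W B x)`**.  NORMALISATION `ξ = 1`: `sliceJet20_field : −½Σ_x τ((divW (field t v))(x)²)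
  = ½·divForm (gram τ t) e (coords v)` (one half of the `gram`-weighted square of the lattice divergence), to be read next to `PlaquetteVertex.jet20_field`
  (`−½·jet20 = ¼·curlForm (gram τ t) = ½·Σ_x Σ_{μ<ν}|curl v|²_{gram}`): the two quadratic jets are `½⟨v, d*d v⟩` and `½⟨v, dd* v⟩` in one colour metric.
  The `(2,1)` jet (the `B`-linear part, `sliceForm₁_eq`) is `−divGerm`, hence in the Hessian convention `S₂ = ½·vᵀHv` of
  `PlaquetteStencil.actionJet21_eq_wilsonVertex₁`: **`sliceJet21_field_bondLetter : −divGerm τ e (field t v) (bondLetter z γ Y) = ½ · v ⬝ᵥ (sliceVertex₁ e z γ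
  (adM τ t Y) *ᵥ v)`**, **`sliceVertex₁ e z γ A := (−2) • divVertex e z γ A`** = MINUS THE LONGITUDINAL VERTEX of `wilsonVertex₁ = vecVertex sTot + 2•divVertex
  + remVertex₁`; so **`bf_vertex : wilsonVertex₁ + sliceVertex₁ = vecVertex sTot + remVertex₁`** and **`bfJet21_field_bondLetter : −½·jet21 − divGerm =
  ½·vᵀ(vecVertex sTot + remVertex₁)v`** — in BF Feynman gauge the longitudinal vertex CANCELS (the lattice, `B`-linear form of B9 (3.26)'s disposal of the
  longitudinal germ, which `PlaquetteWeitzenbock`'s header located as «NOT eliminated (its disposal is the gauge fixing `DRD*`)» — here eliminated).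
* §2 `ℤ⁴` STENCIL (an3-g16's currency): `sliceStn γ A := (−2)•divStn γ A`, `Graded 1`, `real e z z (sliceStn γ A) = sliceVertex₁ e z γ A` on every torus ∕ frame ∕
  bond ∕ colour matrix, list moments `mom0 = 0`, `momX κ = 0`, `momY κ = (−2)•dirBlock γ κ A` (`WilsonCubicGerm.moments_divStn` BY NAME); `real_bfStn`.
* §3 PACKED FIBRE (general `d`): `sEntry d κ′ u x z α β` := the entry of `sliceVertex₁` at the colourless instance (`C := Unit`, `A := 1`, `e := unitVec`,
  `Λ := ℤ^{d+1}`), CLOSED FORM `sEntry_apply : = −2·[x = u ∧ α = κ′]·([z = u + e_{κ′}] − [z = u + e_{κ′} − e_β])` (row leg = the undifferentiated letter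
  `W_{κ′}(u)` AT the background bond, column leg = the backward divergence at its far endpoint); **`sliceA d κ′ u : MKer (d+1) (Fib d)`** = the ANTISYMMETRISED
  field–field block `½(s(x,α;z,β) − s(z,β;x,α))`, zero on the multiplier blocks (verbatim the shape of `wilsonA`); `sEntry_translate`, **`sliceA_translate :
  sliceA d κ′ (u + v) = shiftK (−v) (sliceA d κ′ u)`** (letter (a2)), `sliceA_antisymm`, `abs_sEntry_le : |sEntry| ≤ 2`, finite range `sEntry_eq_zero_or`, and
  **`locStencil_sliceA : 0 ≤ δ → LocStencil (sliceA d) (2·e^{4δ}) δ`** (letter (a1)).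
* §4 `germOfStn V` = the cubic germ READ FROM LIST MOMENTS of a `Unit`-coloured stencil family (`p`-part `½((momX)_{μν} − (momY)_{νμ})`, `q`-part
  `½((momY)_{μν} − (momX)_{νμ})`), additive ∕ homogeneous (`germOfStn_append_smulS`) — the common currency of part 2's «three readings».
Provenance: G-an2-4 formalisation swarm seat b2b-balaban-gan24-formalise-leaf-02 gen 38 (cross-lane on road FP, first refusal R-FP-23 (c)), 2026-08-20∕21.
-/

noncomputable section

namespace Summit.QuantumFields.BalabanUV.Beta.FP.SliceVertex

open Finset
open scoped BigOperators Matrix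
open Literature.MathematicalPhysics.QuantumFieldTheory.Balaban1983to89
open Literature.MathematicalPhysics.QuantumFieldTheory.Balaban1983to89.Beta
open Literature.MathematicalPhysics.QuantumFieldTheory.Balaban1983to89.Beta.DyadicShell (Pt)
open Literature.MathematicalPhysics.QuantumFieldTheory.Balaban1983to89.Beta.GradedBubbles (LP Stn rowSh colSh smulS rowDiff colDiff Graded
  IsStep)
open Literature.MathematicalPhysics.QuantumFieldTheory.Balaban1983to89.Beta.BubbleTable (elemIns elemIns_apply)
open Literature.MathematicalPhysics.QuantumFieldTheory.Balaban1983to89.Beta.SpinTable (br vecVertex spinMat)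
open Literature.MathematicalPhysics.QuantumFieldTheory.Balaban1983to89.Beta.GhostTable (copies)
open Literature.MathematicalPhysics.QuantumFieldTheory.Balaban1983to89.Beta.PlaquetteVertex (field coords adM gram bondLetter jet21)
open Literature.MathematicalPhysics.QuantumFieldTheory.Balaban1983to89.Beta.PlaquetteWeitzenbock (sTot divW divTwist divGerm covDiv₁
  sum_covDiv₁_sq)
open Literature.MathematicalPhysics.QuantumFieldTheory.Balaban1983to89.Beta.PlaquetteStencil (dirBlock dirBlock_apply pairIns divVertex remVertex₁
  wilsonVertex₁ divGerm_field_bondLetter actionJet21_eq_wilsonVertex₁)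
open Literature.MathematicalPhysics.QuantumFieldTheory.Balaban1983to89.Beta.StepJetData (wilsonA l1_unitVec l1_add_le)
open Literature.MathematicalPhysics.QuantumFieldTheory.Balaban1983to89.Beta.OneStepResolventKernel (Fib LocStencil)
open Literature.MathematicalPhysics.QuantumFieldTheory.Balaban1983to89.Beta.OneStepKernelFamily (l1_neg_eq)
open Literature.MathematicalPhysics.QuantumFieldTheory.Balaban1983to89.Beta.ExpKernelCalculus (MKer BiLoc shiftK)
open B12Sec2to5 (l1 l1_nonneg)
open B6BondElimination (unitVec unitVec_apply)
open Summit.QuantumFields.BalabanUV.Beta.GradedStencilDictionary (real lift real_smulS real_append)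
open Summit.QuantumFields.BalabanUV.Beta.FP.GradedStencilMoments
open Summit.QuantumFields.BalabanUV.Beta.WilsonStencilZ4 (divStn vecStn mainStn remStn wilsonStn real_divStn graded_divStn real_vecStn
  real_remStn)
open Summit.QuantumFields.BalabanUV.Beta.FP.MarginalUniqueness (CubicGerm)
open Summit.QuantumFields.BalabanUV.Beta.FP.WilsonCubicGerm (moments_divStn)

/-! ## §1 Ring level: the background-Feynman slice functional at first order, its two jets, the slice vertex, the BF cancellation -/

section RingLevel

variable {𝔸 : Type*} [Ring 𝔸] [Algebra ℝ 𝔸]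
variable {Λ : Type*} [Fintype Λ] [DecidableEq Λ] [AddCommGroup Λ] {C : Type*} [Fintype C] {D : Type*} [Fintype D] [DecidableEq D]

/-- [our object] **THE BACKGROUND-FEYNMAN SLICE FUNCTIONAL AT FIRST ORDER** `−½·Σ_x τ(covDiv₁ e W B x · covDiv₁ e W B x)` — the square of
an3's first-order covariant backward divergence `covDiv₁ = divW + divTwist` (`= −(D*_B W)(x)` of B9 (3.8) at first order in `U = e^{B}`; context), with
the sign/factor `−½` that makes its `(2,0)` jet `+½|d*v|²_{gram}` (`sliceJet20_field`; `τ(t_at_b) = −gram_{ab}`), i.e. `ξ = 1` next to the Wilson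
action's `½|dv|²_{gram}` (`PlaquetteVertex.jet20_field`).  A definition asserting nothing. -/
def sliceForm₁ (τ : 𝔸 →ₗ[ℝ] ℝ) (e : D → Λ) (W B : Λ → D → 𝔸) : ℝ :=
  -((2 : ℝ)⁻¹ * ∑ x, τ (covDiv₁ e W B x * covDiv₁ e W B x))

omit [DecidableEq Λ] [Fintype C] [DecidableEq D] in
/-- [folklore] **THE THREE JETS OF THE SLICE FUNCTIONAL** (`sum_covDiv₁_sq`): `(2,0)` part `−½Σ τ(divW²)`, `(2,1)` part `−divGerm`, `(2,2)` part
`−½Σ τ(divTwist²)`. -/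
theorem sliceForm₁_eq (τ : 𝔸 →ₗ[ℝ] ℝ) (hτ : ∀ a b : 𝔸, τ (a * b) = τ (b * a)) (e : D → Λ) (W B : Λ → D → 𝔸) :
    sliceForm₁ τ e W B =
      -((2 : ℝ)⁻¹ * ∑ x, τ (divW e W x * divW e W x)) - divGerm τ e W B
        - (2 : ℝ)⁻¹ * ∑ x, τ (divTwist e W B x * divTwist e W B x) := by
  rw [sliceForm₁, sum_covDiv₁_sq τ hτ, nsmul_eq_mul, Nat.cast_ofNat]
  ring

/-- [our object] THE LATTICE DIVERGENCE OF A REAL BOND FIELD in coordinates: `(div u)(x)_a = Σ_μ (u_μ(x)_a − u_μ(x − e_μ)_a)` (`divW`'s shape).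
A definition asserting nothing. -/
def divC (e : D → Λ) (u : Λ → D → C → ℝ) (x : Λ) (a : C) : ℝ := ∑ μ, (u x μ a - u (x - e μ) μ a)

/-- [our object] THE `G`-WEIGHTED SQUARE OF THE DIVERGENCE `Σ_x (div u)(x)ᵀ G (div u)(x)` (the analogue of `PlaquetteVertex.curlForm`).  A definition
asserting nothing. -/
def divForm (G : Matrix C C ℝ) (e : D → Λ) (u : Λ → D → C → ℝ) : ℝ := ∑ x, ∑ a, ∑ b, divC e u x a * G a b * divC e u x b

omit [Fintype Λ] [DecidableEq Λ] [DecidableEq D] in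
/-- [folklore] the divergence of the coordinate field is the coordinate combination of the divergences of the coordinates. -/
theorem divW_field (t : C → 𝔸) (e : D → Λ) (v : Λ × (C × D) → ℝ) (x : Λ) :
    divW e (field t v) x = ∑ a, divC e (coords v) x a • t a := by
  simp only [divW, field, coords, divC, ← Finset.sum_sub_distrib, ← sub_smul, Finset.sum_smul]
  exact Finset.sum_comm

omit [DecidableEq Λ] [DecidableEq D] in
/-- [folklore] **THE `(2,0)` JET OF THE SLICE, `ξ = 1`**: `−½Σ_x τ((divW (field t v))(x)²) = ½·divForm (gram τ t) e (coords v)` — one half of the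
`gram`-weighted square of the lattice divergence, to be read next to `PlaquetteVertex.jet20_field`'s `−½·jet20 = ¼·curlForm (gram τ t)` `= ½·Σ_x Σ_{μ<ν}
|curl v|²_{gram}`: the two quadratic jets are `½⟨v, d*d v⟩` and `½⟨v, dd* v⟩` in the same colour metric. -/
theorem sliceJet20_field (τ : 𝔸 →ₗ[ℝ] ℝ) (t : C → 𝔸) (e : D → Λ) (v : Λ × (C × D) → ℝ) :
    -((2 : ℝ)⁻¹ * ∑ x, τ (divW e (field t v) x * divW e (field t v) x)) = (2 : ℝ)⁻¹ * divForm (gram τ t) e (coords v) := by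
  simp only [divW_field, PlaquetteVertex.trace_sum_mul_sum, divForm, Finset.sum_neg_distrib, mul_neg, neg_neg]

end RingLevel

section Vertex

variable {Λ : Type*} [DecidableEq Λ] [AddCommGroup Λ] {C : Type*} {D : Type*} [Fintype D] [DecidableEq D]

/-- [our object] **THE SLICE VERTEX** `(−2)•divVertex e z γ A`: the `B`-linear one-bond Hessian vertex (convention `S₂ = ½·vᵀHv`) of the background-Feynman
slice functional at the background bond `(z, γ)` with colour matrix `A` (`sliceJet21_field_bondLetter`) — MINUS the longitudinal vertex `2•divVertex` of
`PlaquetteStencil.wilsonVertex₁`.  A definition asserting nothing. -/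
def sliceVertex₁ (e : D → Λ) (z : Λ) (γ : D) (A : Matrix C C ℝ) : Matrix (Λ × (C × D)) (Λ × (C × D)) ℝ := (-2 : ℝ) • divVertex e z γ A

/-- [folklore] **THE BACKGROUND-FEYNMAN VERTEX: THE LONGITUDINAL VERTEX CANCELS** — `wilsonVertex₁ + sliceVertex₁ = vecVertex sTot + remVertex₁`
(model vector vertex `current ⊗ 1 + sTot•spin`, `sTot = −2`, plus an3's `Graded 2` remainder; NO longitudinal term). -/
theorem bf_vertex (e : D → Λ) (z : Λ) (γ : D) (A : Matrix C C ℝ) :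
    wilsonVertex₁ e z γ A + sliceVertex₁ e z γ A = vecVertex sTot e z γ A + remVertex₁ e z γ A := by
  rw [wilsonVertex₁, sliceVertex₁, neg_smul]
  abel

end Vertex

section Jet21

variable {𝔸 : Type*} [Ring 𝔸] [Algebra ℝ 𝔸]
variable {Λ : Type*} [Fintype Λ] [DecidableEq Λ] [AddCommGroup Λ] {C : Type*} [Fintype C] {D : Type*} [Fintype D] [DecidableEq D]

/-- [folklore] **THE `(2,1)` JET OF THE SLICE IN COORDINATES**: at the one-bond background `(z, γ, Y)`, for every fluctuation in coordinates `v` and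
every tracial `τ`, `−divGerm τ e (field t v) (bondLetter z γ Y) = ½ · v ⬝ᵥ (sliceVertex₁ e z γ (adM τ t Y) *ᵥ v)`
(`PlaquetteStencil.divGerm_field_bondLetter` BY NAME). -/
theorem sliceJet21_field_bondLetter (τ : 𝔸 →ₗ[ℝ] ℝ) (hτ : ∀ a b : 𝔸, τ (a * b) = τ (b * a)) (t : C → 𝔸) (e : D → Λ)
    (v : Λ × (C × D) → ℝ) (z : Λ) (γ : D) (Y : 𝔸) :
    -divGerm τ e (field t v) (bondLetter z γ Y) = (2 : ℝ)⁻¹ * (v ⬝ᵥ (sliceVertex₁ e z γ (adM τ t Y) *ᵥ v)) := by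
  rw [divGerm_field_bondLetter τ hτ, sliceVertex₁, Matrix.smul_mulVec, dotProduct_smul, smul_eq_mul]
  ring

/-- [folklore] **THE SLICE FUNCTIONAL AT A ONE-BOND BACKGROUND, ALL THREE JETS DISPLAYED**:
`sliceForm₁ τ e (field t v) (bondLetter z γ Y) = ½·divForm (gram τ t) e (coords v) + ½·v ⬝ᵥ (sliceVertex₁ e z γ (adM τ t Y)) v − ½Σ_x τ(divTwist²)`. -/
theorem sliceForm₁_field_bondLetter (τ : 𝔸 →ₗ[ℝ] ℝ) (hτ : ∀ a b : 𝔸, τ (a * b) = τ (b * a)) (t : C → 𝔸) (e : D → Λ)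
    (v : Λ × (C × D) → ℝ) (z : Λ) (γ : D) (Y : 𝔸) :
    sliceForm₁ τ e (field t v) (bondLetter z γ Y) =
      (2 : ℝ)⁻¹ * divForm (gram τ t) e (coords v) + (2 : ℝ)⁻¹ * (v ⬝ᵥ (sliceVertex₁ e z γ (adM τ t Y) *ᵥ v))
        - (2 : ℝ)⁻¹ * ∑ x, τ (divTwist e (field t v) (bondLetter z γ Y) x * divTwist e (field t v) (bondLetter z γ Y) x) := by
  rw [sliceForm₁_eq τ hτ, sliceJet20_field, ← sliceJet21_field_bondLetter τ hτ]
  ring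

end Jet21

section Headline

variable {𝔸 : Type*} [NormedRing 𝔸] [NormedAlgebra ℝ 𝔸]
variable {Λ : Type*} [Fintype Λ] [DecidableEq Λ] [AddCommGroup Λ] {C : Type*} [Fintype C] {D : Type*} [Fintype D] [DecidableEq D]

/-- [folklore] **HEADLINE — WILSON `(2,1)` JET + SLICE `(2,1)` JET = THE MODEL VECTOR VERTEX + THE REMAINDER, NO LONGITUDINAL TERM.**  In the Hessian
convention `S₂ = ½·vᵀHv` (`PlaquetteStencil.actionJet21_eq_wilsonVertex₁`: `−½·jet21 = ½·vᵀ wilsonVertex₁ v`), at the one-bond background `(z, γ, Y)`,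
for EVERY fluctuation in coordinates `v` and every tracial `τ`:
`−½·jet21 ℝ τ e (field t v) (bondLetter z γ Y) − divGerm τ e (field t v) (bondLetter z γ Y) = ½ · v ⬝ᵥ ((vecVertex sTot + remVertex₁) e z γ (adM τ t Y)) v`. -/
theorem bfJet21_field_bondLetter (τ : 𝔸 →ₗ[ℝ] ℝ) (hτ : ∀ a b : 𝔸, τ (a * b) = τ (b * a)) (t : C → 𝔸) (e : D → Λ)
    (v : Λ × (C × D) → ℝ) (z : Λ) (γ : D) (Y : 𝔸) :
    -((2 : ℝ)⁻¹ * jet21 ℝ τ e (field t v) (bondLetter z γ Y)) + -divGerm τ e (field t v) (bondLetter z γ Y) =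
      (2 : ℝ)⁻¹ * (v ⬝ᵥ ((vecVertex sTot e z γ (adM τ t Y) + remVertex₁ e z γ (adM τ t Y)) *ᵥ v)) := by
  rw [actionJet21_eq_wilsonVertex₁ τ hτ, sliceJet21_field_bondLetter τ hτ, ← bf_vertex, Matrix.add_mulVec, dotProduct_add]
  ring

end Headline

/-! ## §2 The `ℤ⁴` stencil of the slice vertex, its grading, realisation and list moments -/

section Stencil

variable {C : Type*}

/-- [our object] **THE SLICE STENCIL** `(−2)•divStn γ A` (an3-g16's `GradedBubbles` currency; realised: `sliceVertex₁`).  A definition asserting nothing. -/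
def sliceStn (γ : Fin 4) (A : Matrix C C ℝ) : Stn (C × Fin 4) := smulS (-2) (divStn γ A)

/-- [folklore] `Graded 1 (sliceStn γ A)` (one unit-step column difference: the divergence leg). -/
theorem graded_sliceStn (γ : Fin 4) (A : Matrix C C ℝ) : Graded 1 (sliceStn γ A) := Graded.smul _ (graded_divStn γ A)

/-- [folklore] **LIST MOMENTS OF THE SLICE STENCIL**: `mom0 = 0`, `momX κ = 0` (the row leg sits AT the background site), `momY κ = (−2)•dirBlock γ κ A`
(`WilsonCubicGerm.moments_divStn` BY NAME). -/
theorem moments_sliceStn (γ : Fin 4) (A : Matrix C C ℝ) (κ : Fin 4) :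
    mom0 (sliceStn γ A) = 0 ∧ momX (sliceStn γ A) κ = 0 ∧ momY (sliceStn γ A) κ = (-2 : ℝ) • dirBlock γ κ A := by
  obtain ⟨h0, hx, hy⟩ := moments_smulS (-2 : ℝ) (divStn γ A) κ
  obtain ⟨dx, dy⟩ := moments_divStn γ A κ
  refine ⟨?_, ?_, ?_⟩
  · rw [sliceStn, h0, (moments_of_graded (graded_divStn γ A)).1 le_rfl, smul_zero]
  · rw [sliceStn, hx, dx, smul_zero]
  · rw [sliceStn, hy, dy]

variable {Λ : Type*} [DecidableEq Λ] [AddCommGroup Λ] (e : Fin 4 → Λ)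

/-- [folklore] **THE SLICE DICTIONARY**: `real e z z (sliceStn γ A) = sliceVertex₁ e z γ A` on every torus, every frame, every bond and colour matrix. -/
theorem real_sliceStn (z : Λ) (γ : Fin 4) (A : Matrix C C ℝ) : real e z z (sliceStn γ A) = sliceVertex₁ e z γ A := by
  rw [sliceStn, real_smulS, real_divStn, sliceVertex₁]

/-- [folklore] the BACKGROUND-FEYNMAN stencil `vecStn sTot ++ remStn` realises the BF vertex `vecVertex sTot + remVertex₁` (`= wilsonVertex₁ + sliceVertex₁`,
`bf_vertex`), and `wilsonStn ++ sliceStn` realises the same matrix. -/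
theorem real_bfStn (z : Λ) (γ : Fin 4) (A : Matrix C C ℝ) :
    real e z z (vecStn sTot γ A ++ remStn γ A) = wilsonVertex₁ e z γ A + sliceVertex₁ e z γ A ∧
      real e z z (wilsonStn γ A ++ sliceStn γ A) = wilsonVertex₁ e z γ A + sliceVertex₁ e z γ A := by
  refine ⟨?_, ?_⟩
  · rw [real_append, real_vecStn, real_remStn, bf_vertex]
  · rw [real_append, WilsonStencilZ4.real_wilsonStn, real_sliceStn]

end Stencil

/-! ## §3 The packed-fibre family `sliceA` in the `ad(t_c)`-stripping convention (general `d`) -/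

section Packed

variable {d : ℕ}

/-- [our object] AN ENTRY of the slice vertex at the colourless instance (`C := Unit`, `A := 1`, `e := unitVec`, `Λ := ℤ^{d+1}`): row `(x, α)`, column
`(z, β)`, background bond `(κ′, u)` — verbatim the shape of `StepJetData.wEntry`.  A definition asserting nothing. -/
def sEntry (d : ℕ) (κ' : Fin (d + 1)) (u x z : Fin (d + 1) → ℤ) (α β : Fin (d + 1)) : ℝ :=
  sliceVertex₁ (C := Unit) (unitVec (d := d + 1)) u κ' (1 : Matrix Unit Unit ℝ) (x, ((), α)) (z, ((), β))

/-- [folklore] **CLOSED FORM**: `sEntry d κ′ u x z α β = −2·[x = u ∧ α = κ′]·([z = u + e_{κ′}] − [z = u + e_{κ′} − e_β])` — the row leg is the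
undifferentiated letter `W_{κ′}(u)` at the background bond, the column leg the backward divergence `Σ_β (W_β(u+e_{κ′}) − W_β(u+e_{κ′}−e_β))` at its far
endpoint. -/
theorem sEntry_apply (κ' : Fin (d + 1)) (u x z : Fin (d + 1) → ℤ) (α β : Fin (d + 1)) :
    sEntry d κ' u x z α β =
      -2 * (if x = u ∧ α = κ' then
        ((if z = u + unitVec κ' then (1 : ℝ) else 0) - (if z = u + unitVec κ' - unitVec β then (1 : ℝ) else 0)) else 0) := by
  unfold sEntry sliceVertex₁
  rw [Matrix.smul_apply, smul_eq_mul, divVertex, Matrix.sum_apply]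
  congr 1
  simp only [Matrix.sub_apply, pairIns, elemIns_apply, dirBlock_apply, Matrix.one_apply_eq]
  by_cases hx : x = u
  · by_cases hα : α = κ'
    · simp only [hx, hα, true_and, if_true]
      rw [Finset.sum_sub_distrib]
      congr 1
      · rw [Finset.sum_eq_single β (fun b _ hb => by rw [if_neg (Ne.symm hb), ite_self]) (fun h => absurd (Finset.mem_univ β) h)]
        simp only [if_true]
      · rw [Finset.sum_eq_single β (fun b _ hb => by rw [if_neg (Ne.symm hb), ite_self]) (fun h => absurd (Finset.mem_univ β) h)]
        simp only [if_true]
    · simp only [hx, hα, true_and, false_and, and_false, if_false, ite_self, Finset.sum_const_zero, sub_zero]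
  · simp only [hx, false_and, if_false, Finset.sum_const_zero, sub_zero]

/-- [our object] **THE SLICE'S FIELD-BLOCK STENCIL, STRIPPED IN THE `ad(t_c)`-COEFFICIENT CONVENTION** `sliceA d κ′ u`: on the field block the
ANTISYMMETRISED colourless slice-vertex entries `½·(s(x,α; z,β) − s(z,β; x,α))` (`s = sEntry`), zero on every block touching a multiplier leg — the
convention of `StepJetData.wilsonA` (a colourless stencil is the coefficient of `ad(t_c)`, hence antisymmetric), so that `wilsonA d + sliceA d` is the
background-Feynman first-order family at level `0`.  A definition asserting nothing. -/
def sliceA (d : ℕ) (κ' : Fin (d + 1)) (u : Fin (d + 1) → ℤ) : MKer (d + 1) (Fib d) :=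
  fun x z a b =>
    match a, b with
    | Sum.inl α, Sum.inl β => (1 / 2) * (sEntry d κ' u x z α β - sEntry d κ' u z x β α)
    | Sum.inl _, Sum.inr _ => 0
    | Sum.inr _, Sum.inl _ => 0
    | Sum.inr _, Sum.inr _ => 0

/-- [folklore] the field–field block of `sliceA` (definitional). -/
theorem sliceA_inl_inl (κ' : Fin (d + 1)) (u x z : Fin (d + 1) → ℤ) (α β : Fin (d + 1)) :
    sliceA d κ' u x z (Sum.inl α) (Sum.inl β) = (1 / 2 : ℝ) * (sEntry d κ' u x z α β - sEntry d κ' u z x β α) := rfl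

/-- [folklore] TRANSLATION COVARIANCE of the entries: `s(u + v; x, z) = s(u; x − v, z − v)`. -/
theorem sEntry_translate (κ' : Fin (d + 1)) (u v x z : Fin (d + 1) → ℤ) (α β : Fin (d + 1)) :
    sEntry d κ' (u + v) x z α β = sEntry d κ' u (x - v) (z - v) α β := by
  simp only [sEntry_apply, sub_eq_iff_eq_add, add_right_comm u v, sub_add_eq_add_sub]

/-- [folklore] **FINE-TRANSLATION COVARIANCE** of `sliceA` (letter (a2); the shape of `StepJetData.wilsonA_translate`):
`sliceA d κ′ (u + v) = shiftK (−v) (sliceA d κ′ u)`. -/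
theorem sliceA_translate (κ' : Fin (d + 1)) (u v : Fin (d + 1) → ℤ) : sliceA d κ' (u + v) = shiftK (-v) (sliceA d κ' u) := by
  funext x z a b
  show sliceA d κ' (u + v) x z a b = sliceA d κ' u (x + -v) (z + -v) a b
  rcases a with α | α <;> rcases b with β | β
  · show 1 / 2 * (sEntry d κ' (u + v) x z α β - sEntry d κ' (u + v) z x β α) =
      1 / 2 * (sEntry d κ' u (x + -v) (z + -v) α β - sEntry d κ' u (z + -v) (x + -v) β α)
    rw [sEntry_translate, sEntry_translate, ← sub_eq_add_neg, ← sub_eq_add_neg]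
  all_goals rfl

/-- [folklore] `sliceA` IS ANTISYMMETRIC under exchanging the two legs. -/
theorem sliceA_antisymm (κ' : Fin (d + 1)) (u x z : Fin (d + 1) → ℤ) (a b : Fib d) :
    sliceA d κ' u z x b a = -sliceA d κ' u x z a b := by
  rcases a with α | α <;> rcases b with β | β
  · show 1 / 2 * (sEntry d κ' u z x β α - sEntry d κ' u x z α β) = -(1 / 2 * (sEntry d κ' u x z α β - sEntry d κ' u z x β α))
    ring
  all_goals exact neg_zero.symm

/-- [folklore] UNIFORM ENTRY BOUND `|sEntry| ≤ 2`. -/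
theorem abs_sEntry_le (κ' : Fin (d + 1)) (u x z : Fin (d + 1) → ℤ) (α β : Fin (d + 1)) : |sEntry d κ' u x z α β| ≤ 2 := by
  rw [sEntry_apply]
  split_ifs <;> norm_num

/-- [folklore] FINITE RANGE: an entry vanishes unless the row site IS the background site and the column site lies within `ℓ¹`-distance 2 of it. -/
theorem sEntry_eq_zero_or (κ' : Fin (d + 1)) (u x z : Fin (d + 1) → ℤ) (α β : Fin (d + 1)) :
    sEntry d κ' u x z α β = 0 ∨ (l1 (x - u) ≤ 2 ∧ l1 (z - u) ≤ 2) := by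
  rw [sEntry_apply]
  by_cases hx : x = u ∧ α = κ'
  · by_cases hz1 : z = u + unitVec κ'
    · refine Or.inr ⟨?_, ?_⟩
      · rw [hx.1, sub_self]
        unfold B12Sec2to5.l1
        simp
      · rw [hz1, add_sub_cancel_left, l1_unitVec]
        norm_num
    · by_cases hz2 : z = u + unitVec κ' - unitVec β
      · refine Or.inr ⟨?_, ?_⟩
        · rw [hx.1, sub_self]
          unfold B12Sec2to5.l1
          simp
        · rw [hz2, add_sub_assoc, add_sub_cancel_left, sub_eq_add_neg]
          refine (l1_add_le _ _).trans ?_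
          rw [l1_neg_eq, l1_unitVec, l1_unitVec]
          norm_num
      · left
        rw [if_pos hx, if_neg hz1, if_neg hz2, sub_zero, mul_zero]
  · left
    rw [if_neg hx, mul_zero]

/-- [folklore] ENTRY BOUND IN `LocStencil` SHAPE for any rate `δ ≥ 0` (finite range ⇒ the factor `e^{4δ}`). -/
theorem abs_sEntry_le_exp {δ : ℝ} (hδ : 0 ≤ δ) (κ' : Fin (d + 1)) (u x z : Fin (d + 1) → ℤ) (α β : Fin (d + 1)) :
    |sEntry d κ' u x z α β| ≤ 2 * Real.exp (4 * δ) * Real.exp (-δ * (l1 (x - u) + l1 (z - u))) := by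
  rcases sEntry_eq_zero_or κ' u x z α β with h | ⟨hx, hz⟩
  · rw [h, abs_zero]
    positivity
  · have h1 : 1 ≤ Real.exp (4 * δ) * Real.exp (-δ * (l1 (x - u) + l1 (z - u))) := by
      rw [← Real.exp_add]
      exact Real.one_le_exp (by nlinarith [mul_nonneg hδ (sub_nonneg.2 hx), mul_nonneg hδ (sub_nonneg.2 hz)])
    calc |sEntry d κ' u x z α β| ≤ 2 * 1 := by rw [mul_one]; exact abs_sEntry_le κ' u x z α β
      _ ≤ 2 * (Real.exp (4 * δ) * Real.exp (-δ * (l1 (x - u) + l1 (z - u)))) := mul_le_mul_of_nonneg_left h1 (by norm_num)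
      _ = _ := by ring

/-- [folklore] **`sliceA` IS A LOCAL STENCIL FAMILY** for every rate `δ ≥ 0`, constant `2·e^{4δ}` (letter (a1); the shape of `StepJetData.locStencil_wilsonA`). -/
theorem locStencil_sliceA {δ : ℝ} (hδ : 0 ≤ δ) : LocStencil (sliceA d) (2 * Real.exp (4 * δ)) δ := by
  intro κ' u x z a b
  have h0 : |(0 : ℝ)| ≤ 2 * Real.exp (4 * δ) * Real.exp (-δ * (l1 (x - u) + l1 (z - u))) := by
    rw [abs_zero]
    positivity
  rcases a with α | α <;> rcases b with β | β
  · show |1 / 2 * (sEntry d κ' u x z α β - sEntry d κ' u z x β α)| ≤ _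
    have h1 := abs_sEntry_le_exp hδ κ' u x z α β
    have h2 := abs_sEntry_le_exp hδ κ' u z x β α
    rw [add_comm (l1 (z - u)) (l1 (x - u))] at h2
    rw [abs_mul, abs_of_pos (by norm_num : (0 : ℝ) < 1 / 2)]
    have h3 := abs_sub (sEntry d κ' u x z α β) (sEntry d κ' u z x β α)
    linarith [h1, h2, h3]
  all_goals exact h0

end Packed

/-! ## §4 The germ read from the list moments of a `Unit`-coloured stencil family -/

section GermOfStn

/-- [our object] THE GERM READ FROM LIST MOMENTS of a `Unit`-coloured `ℤ⁴` stencil family `V : Fin 4 → Stn (Unit × Fin 4)` (background direction ↦ stencil):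
`p`-part `½((momX)_{μν} − (momY)_{νμ})`, `q`-part `½((momY)_{μν} − (momX)_{νμ})` — the first moments of the antisymmetrised pairing, so that
`cubicGermOf (wilsonA 3) = germOfStn (wilsonStn · 1)` and `cubicGermOf (sliceA 3) = germOfStn (sliceStn · 1)` (`_eq_moments`).  A definition asserting nothing. -/
def germOfStn (V : Fin 4 → Stn (Unit × Fin 4)) : CubicGerm := fun μ ν lam κ i =>
  (1 / 2 : ℝ) *
    (if i = 0 then momX (V lam) κ ((), μ) ((), ν) - momY (V lam) κ ((), ν) ((), μ)
    else momY (V lam) κ ((), μ) ((), ν) - momX (V lam) κ ((), ν) ((), μ))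

/-- [folklore] `germOfStn` is additive under member-wise concatenation and homogeneous under member-wise scaling. -/
theorem germOfStn_append_smulS (V W : Fin 4 → Stn (Unit × Fin 4)) (c : ℝ) :
    germOfStn (fun lam => V lam ++ W lam) = germOfStn V + germOfStn W ∧
      germOfStn (fun lam => smulS c (V lam)) = c • germOfStn V := by
  refine ⟨?_, ?_⟩
  · funext μ ν lam κ i
    obtain ⟨-, hx, hy⟩ := moments_append (V lam) (W lam) κ
    simp only [germOfStn, hx, hy, Pi.add_apply, Matrix.add_apply]
    split_ifs <;> ring
  · funext μ ν lam κ i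
    obtain ⟨-, hx, hy⟩ := moments_smulS c (V lam) κ
    simp only [germOfStn, hx, hy, Pi.smul_apply, Matrix.smul_apply, smul_eq_mul]
    split_ifs <;> ring

end GermOfStn

end Summit.QuantumFields.BalabanUV.Beta.FP.SliceVertex
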